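import Summits.Ventures.HodgeRepro.SingleClass16Witness
import Summits.Ventures.HodgeRepro.CyclicCosetThreshold
import Summits.Ventures.HodgeRepro.KleinCosetThreshold
import Summits.Ventures.HodgeRepro.NondegenerateNoSingleClassGeneral

/-!
# Degree 24: both coset thresholds are SHARP, and a non-coset single-class quadruple on an ABELIAN group

Blind re-derivation cell `pub-hodge-repro`, seat `p1` (gen 8).  Continues `SingleClass16Witness.lean`
(degree 16: the first single-class `SumTwo` quadruple without a conjugate pair, on `C₄ × C₄`, a coset of a
CYCLIC subgroup of order `4`), `CyclicCosetThreshold.lean` (`sixteen_le_card_of_cyclicQuad`: such a cyclic-coset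
quadruple forces `|G| ≥ 16`) and `KleinCosetThreshold.lean` (`twentyfour_le_card_of_kleinQuad`: a Klein-coset
one forces `|G| ≥ 24`).  This file shows on the kernel that BOTH bounds are attained, and exhibits the third
mechanism of the degree-24 frontier (ROUTE.md §3.4, until now a Python count) on an abelian group:

* `cyclic_threshold_sharp`: on `C₄ × C₄` (order `16`) the witness `Φ₁₆`, `a = (1, 2)` of `SingleClass16Witness`
  satisfies every hypothesis of `sixteen_le_card_of_cyclicQuad` — `16` is the exact threshold of the cyclic-coset
  mechanism;
* `klein_threshold_sharp`: on `C₆ × C₂ × C₂` (order `24`) with `c = (0, 0, 1)`, the primitive CM type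
  `Φ₂₄ᴷ = {(0,0,0), (0,1,0), (1,0,0), (1,1,0), (2,0,0), (2,1,1), (3,0,0), (3,1,0), (4,0,1), (4,1,1), (5,0,0), (5,1,1)}`
  and the Klein subgroup `Δᴷ = {1, a, b, ab}`, `a = (0, 1, 1)`, `b = (3, 0, 1)` (not containing `c`) satisfy every
  hypothesis of `twentyfour_le_card_of_kleinQuad`: the quadruple `(Φ, Φa, Φb, Φab)` is `SumTwo` without a
  conjugate pair, pattern `(4, 4, 4)` — `24` is the exact threshold of the Klein-coset mechanism;
* `exists_singleClass_sumTwo_nonCoset_C6xC2xC2`: on the same abelian group the primitive CM type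
  `Φ₂₄ᴺ = {(0,0,0), (0,1,0), (1,0,0), (1,1,0), (2,0,0), (2,1,0), (3,0,0), (3,1,1), (4,0,0), (4,1,1), (5,0,0), (5,1,1)}`
  and the twists `g = (1,0,1), (3,0,0), (4,0,1)` form a single-class `SumTwo` quadruple without a conjugate pair,
  pattern `(2, 6, 4)`, whose Pohlmann `4`-set `Δᴺ = {1, g₁⁻¹, g₂⁻¹, g₃⁻¹}` is NOT a coset of any subgroup
  (`Δ24N_not_coset`, via the decidable criterion `not_exists_coset_of_forall`) — at degree 16 the non-coset
  mechanism occurred only on the non-abelian groups `SD₁₆`, `M₁₆`; at degree 24 it occurs on an abelian group.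

Reading (Pohlmann's criterion, Gordon §9.2 / Milne (eq2) as printed in `route/SOURCES.md`): for a Galois CM
field `F` with group `C₆ × C₂ × C₂` (e.g. `ℚ(ζ₇ + ζ₇⁻¹, √2, √3, √−1)`) and `K' = F^{Δᴷ}` — a cyclic SEXTIC CM
subfield, `F/K'` biquadratic — `H¹(A_{Φ₂₄ᴷ})` is a `4`-dimensional `K'`-space of balanced `K'`-signature (every
coset `xΔᴷ` meets `Φ₂₄ᴷ` in exactly two embeddings: `SumTwo`), so `∧⁴_{K'} H¹ ⊂ H⁴(A)` is a space of Hodge classes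
of Weil type relative to `K'`, in codimension `2`, on the SIMPLE CM abelian `12`-fold `A_{Φ₂₄ᴷ}`; Pohlmann's
condition on the `4`-sets themselves is the typer's verbatim `IsHodgeSet`, and `IsExceptional` (the set is not
conjugation-stable) says the class is not a product of divisor classes — both decided here for `Δᴷ` and for the
non-coset `Δᴺ`, which is Weil relative to NO subfield.  By `HazamaShadow.not_isSingleClass_of_isNondegenerate`
(gen 7) every such base type is DEGENERATE: `Φ16_not_isNondegenerate`, `Φ24K_not_isNondegenerate`,
`Φ24N_not_isNondegenerate` — the kernel form of «the census never contradicts Hazama's theorem» (Gordon Thm 6.4).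
Census (`proofs/p1-g6/klein24.py`, route-2 g14 `deg24_all.py`, p1 g8 `deg24wit.py`): on `(C₆ × C₂ × C₂, c)`
exactly `192` pointed Klein-coset instances (all pattern `(4,4,4)`) and `288` non-coset ones (all `(6,4,2)`),
all on primitive types, `0` cyclic-coset ones (the group has no element of order `4`).
-/

set_option autoImplicit false

open Finset
open scoped Pointwise

namespace HodgeRepro

/-! ### A decidable criterion for «not a coset of a subgroup» -/

section Coset

variable {G : Type*} [Group G] [DecidableEq G]

/-- If for every `h ∈ Δ` the translate `Δ h⁻¹` is not closed under multiplication, then `Δ` is not a (right)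
coset `H h` of a subgroup `H` (a coset translated by the inverse of one of its elements is the subgroup itself).
The hypothesis is decidable on a finite group. -/
theorem not_exists_coset_of_forall (Δ : Finset G)
    (hΔ : ∀ h ∈ Δ, ∃ x ∈ Δ, ∃ y ∈ Δ, x * h⁻¹ * (y * h⁻¹) ∉ Δ.image (· * h⁻¹)) :
    ¬ ∃ (H : Subgroup G) (h : G), ∀ x, x ∈ Δ ↔ ∃ k ∈ H, x = k * h := by
  rintro ⟨H, h, hH⟩
  have hh : h ∈ Δ := (hH h).2 ⟨1, H.one_mem, (one_mul h).symm⟩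
  obtain ⟨x, hx, y, hy, hxy⟩ := hΔ h hh
  obtain ⟨k₁, hk₁, rfl⟩ := (hH x).1 hx
  obtain ⟨k₂, hk₂, rfl⟩ := (hH y).1 hy
  apply hxy
  rw [Finset.mem_image]
  refine ⟨k₁ * k₂ * h, (hH _).2 ⟨k₁ * k₂, H.mul_mem hk₁ hk₂, rfl⟩, ?_⟩
  simp only [mul_inv_cancel_right]

end Coset

/-! ### The cyclic threshold `16` is attained (`C₄ × C₄`, the gen-6 witness) -/

/-- The order-`4` twist `(1, 2)` of `SingleClass16Witness` has order `4`. -/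
theorem orderOf_gen_C4xC4 : orderOf gen_C4xC4 = 4 := by
  rw [orderOf_eq_iff (by norm_num)]
  decide

/-- `a² ≠ c` for the gen-6 witness: the subgroup `⟨(1,2)⟩` does not contain `c = (0, 2)`. -/
theorem gen_C4xC4_sq_ne : gen_C4xC4 ^ 2 ≠ cc_C4xC4 := by decide

/-- The gen-6 quadruple `T₁₆` IS the `cyclicQuad` of `Φ₁₆` and `(1, 2)`. -/
theorem cyclicQuad_Φ16 : cyclicQuad Φ16 gen_C4xC4 = T16 := by decide

/-- **The cyclic-coset threshold is sharp**: every hypothesis of `sixteen_le_card_of_cyclicQuad` holds on a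
group of order `16` (`C₄ × C₄`, `c = (0,2)`, `Φ₁₆`, `a = (1,2)`). -/
theorem cyclic_threshold_sharp :
    ∃ (c : C4xC4) (Φ : Finset C4xC4) (a : C4xC4),
      IsComplexConj c ∧ IsCMType c Φ ∧ orderOf a = 4 ∧ a ^ 2 ≠ c ∧ SumTwo (cyclicQuad Φ a) ∧
        (∀ i j : Fin 4, cyclicQuad Φ a j ≠ c • cyclicQuad Φ a i) ∧ Fintype.card C4xC4 = 16 :=
  ⟨cc_C4xC4, Φ16, gen_C4xC4, cc_C4xC4_isComplexConj, Φ16_isCMType, orderOf_gen_C4xC4, gen_C4xC4_sq_ne,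
    by rw [cyclicQuad_Φ16]; exact sumTwo_T16, by rw [cyclicQuad_Φ16]; exact T16_noConjugatePair, by decide⟩

/-- The gen-6 base type `Φ₁₆` is DEGENERATE (Hazama's shadow, gen 7): a single-class `SumTwo` quadruple of its
twists without a conjugate pair exists. -/
theorem Φ16_not_isNondegenerate : ¬ IsNondegenerate Φ16 := fun hnd =>
  HazamaShadow.not_isSingleClass_of_isNondegenerate cc_C4xC4_isComplexConj T16 Φ16_isCMType hnd sumTwo_T16
    T16_noConjugatePair T16_isSingleClass

/-! ### Degree 24: `C₆ × C₂ × C₂` -/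

/-- The group `C₆ × C₂ × C₂` of order `24`, written multiplicatively (as `Groups.lean` writes `C₆ × C₂`). -/
abbrev C6xC2xC2 := Multiplicative (ZMod 6 × ZMod 2 × ZMod 2)

/-- The complex conjugation `(0, 0, 1)` of `C₆ × C₂ × C₂` (all seven involutions are equivalent under
automorphisms of the group). -/
def cc_C6xC2xC2 : C6xC2xC2 := Multiplicative.ofAdd (0, 0, 1)

/-- `cc_C6xC2xC2` is a complex conjugation (`decide`). -/
theorem cc_C6xC2xC2_isComplexConj : IsComplexConj cc_C6xC2xC2 := by decide

/-- `|C₆ × C₂ × C₂| = 24`. -/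
theorem card_C6xC2xC2 : Fintype.card C6xC2xC2 = 24 := by decide

/-! #### The Klein-coset witness, pattern `(4, 4, 4)` -/

/-- The CM type `Φ₂₄ᴷ` of `(C₆ × C₂ × C₂, (0,0,1))`. -/
def Φ24K : Finset C6xC2xC2 :=
  {Multiplicative.ofAdd (0, 0, 0), Multiplicative.ofAdd (0, 1, 0), Multiplicative.ofAdd (1, 0, 0),
   Multiplicative.ofAdd (1, 1, 0), Multiplicative.ofAdd (2, 0, 0), Multiplicative.ofAdd (2, 1, 1),
   Multiplicative.ofAdd (3, 0, 0), Multiplicative.ofAdd (3, 1, 0), Multiplicative.ofAdd (4, 0, 1),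
   Multiplicative.ofAdd (4, 1, 1), Multiplicative.ofAdd (5, 0, 0), Multiplicative.ofAdd (5, 1, 1)}

/-- The involution `a = (0, 1, 1)`. -/
def a24 : C6xC2xC2 := Multiplicative.ofAdd (0, 1, 1)

/-- The involution `b = (3, 0, 1)`; `{1, a, b, ab}` is a Klein subgroup not containing `c`. -/
def b24 : C6xC2xC2 := Multiplicative.ofAdd (3, 0, 1)

/-- `Φ₂₄ᴷ` is a CM type. -/
theorem Φ24K_isCMType : IsCMType cc_C6xC2xC2 Φ24K := by decide

/-- `Φ₂₄ᴷ` is primitive (`A_{Φ₂₄ᴷ}` is a SIMPLE CM abelian `12`-fold). -/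
theorem Φ24K_isPrimitive : IsPrimitive Φ24K := by decide

/-- The Klein quadruple `(Φ, Φa, Φb, Φab)` of `Φ₂₄ᴷ` is `SumTwo`. -/
theorem sumTwo_kleinQuad24 : SumTwo (kleinQuad Φ24K a24 b24) := by
  unfold SumTwo; decide

/-- No two corners of the Klein quadruple are complex-conjugate types. -/
theorem kleinQuad24_noConjugatePair :
    ∀ i j : Fin 4, kleinQuad Φ24K a24 b24 j ≠ cc_C6xC2xC2 • kleinQuad Φ24K a24 b24 i := by decide

/-- The Klein quadruple is single-class (every corner is a right translate of `Φ₂₄ᴷ`). -/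
theorem kleinQuad24_isSingleClass : IsSingleClass (kleinQuad Φ24K a24 b24) := by decide

/-- Pairing pattern `(4, 4, 4)`: `|Φ ∩ Φa| = |Φ ∩ Φb| = |Φ ∩ Φab| = 4`. -/
theorem kleinQuad24_pattern :
    (Φ24K ∩ rmul Φ24K a24).card = 4 ∧ (Φ24K ∩ rmul Φ24K b24).card = 4 ∧
      (Φ24K ∩ rmul Φ24K (a24 * b24)).card = 4 := by decide

/-- The four corners are pairwise distinct. -/
theorem kleinQuad24_nodup : ∀ i j : Fin 4, kleinQuad Φ24K a24 b24 i = kleinQuad Φ24K a24 b24 j → i = j := by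
  decide

/-- The Pohlmann `4`-set of the Klein quadruple: the subgroup `Δᴷ = {1, a, b, ab}` itself. -/
def Δ24K : Finset C6xC2xC2 := {1, a24, b24, a24 * b24}

/-- `⟨Δᴷ⟩` is an exceptional Hodge class candidate on `A_{Φ₂₄ᴷ}` in the typer's verbatim Pohlmann vocabulary:
`IsHodgeSet` (`|τΔ ∩ Φ| = |τΔ ∩ Φ̄|` for every `τ`) and `Δᴷ` not conjugation-stable. -/
theorem Δ24K_isExceptional : IsExceptional cc_C6xC2xC2 Φ24K Δ24K := by decide

/-- **The Klein-coset threshold is sharp**: every hypothesis of `twentyfour_le_card_of_kleinQuad` holds on a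
group of order `24`. -/
theorem klein_threshold_sharp :
    ∃ (c : C6xC2xC2) (Φ : Finset C6xC2xC2) (a b : C6xC2xC2),
      IsComplexConj c ∧ IsCMType c Φ ∧ a * a = 1 ∧ b * b = 1 ∧ a * b = b * a ∧ a ≠ 1 ∧ b ≠ 1 ∧ a ≠ b ∧
        c ≠ a ∧ c ≠ b ∧ c ≠ a * b ∧ SumTwo (kleinQuad Φ a b) ∧
        (∀ i j : Fin 4, kleinQuad Φ a b j ≠ c • kleinQuad Φ a b i) ∧ Fintype.card C6xC2xC2 = 24 :=
  ⟨cc_C6xC2xC2, Φ24K, a24, b24, cc_C6xC2xC2_isComplexConj, Φ24K_isCMType, by decide, by decide, by decide,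
    by decide, by decide, by decide, by decide, by decide, by decide, sumTwo_kleinQuad24,
    kleinQuad24_noConjugatePair, card_C6xC2xC2⟩

/-- The Klein-coset witness in the shape of `SingleClass16Witness`: a PRIMITIVE single-class `SumTwo` quadruple
without a conjugate pair on a group of order `24`. -/
theorem exists_singleClass_sumTwo_primitive_klein_C6xC2xC2 :
    ∃ T : Fin 4 → Finset C6xC2xC2, IsCMType cc_C6xC2xC2 (T 0) ∧ IsPrimitive (T 0) ∧ SumTwo T ∧
      (∀ i j : Fin 4, T j ≠ cc_C6xC2xC2 • T i) ∧ IsSingleClass T :=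
  ⟨kleinQuad Φ24K a24 b24, Φ24K_isCMType, Φ24K_isPrimitive, sumTwo_kleinQuad24, kleinQuad24_noConjugatePair,
    kleinQuad24_isSingleClass⟩

/-- `Φ₂₄ᴷ` is DEGENERATE (Hazama's shadow). -/
theorem Φ24K_not_isNondegenerate : ¬ IsNondegenerate Φ24K := fun hnd =>
  HazamaShadow.not_isSingleClass_of_isNondegenerate cc_C6xC2xC2_isComplexConj (kleinQuad Φ24K a24 b24)
    Φ24K_isCMType hnd sumTwo_kleinQuad24 kleinQuad24_noConjugatePair kleinQuad24_isSingleClass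

/-! #### The non-coset witness, pattern `(2, 6, 4)` -/

/-- The CM type `Φ₂₄ᴺ` of `(C₆ × C₂ × C₂, (0,0,1))`. -/
def Φ24N : Finset C6xC2xC2 :=
  {Multiplicative.ofAdd (0, 0, 0), Multiplicative.ofAdd (0, 1, 0), Multiplicative.ofAdd (1, 0, 0),
   Multiplicative.ofAdd (1, 1, 0), Multiplicative.ofAdd (2, 0, 0), Multiplicative.ofAdd (2, 1, 0),
   Multiplicative.ofAdd (3, 0, 0), Multiplicative.ofAdd (3, 1, 1), Multiplicative.ofAdd (4, 0, 0),
   Multiplicative.ofAdd (4, 1, 1), Multiplicative.ofAdd (5, 0, 0), Multiplicative.ofAdd (5, 1, 1)}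

/-- The twists `1, (1,0,1), (3,0,0), (4,0,1)`. -/
def g24 : Fin 4 → C6xC2xC2 :=
  ![1, Multiplicative.ofAdd (1, 0, 1), Multiplicative.ofAdd (3, 0, 0), Multiplicative.ofAdd (4, 0, 1)]

/-- The quadruple `T₂₄ᴺ i = Φ₂₄ᴺ · g i`. -/
def T24N (i : Fin 4) : Finset C6xC2xC2 := rmul Φ24N (g24 i)

/-- `Φ₂₄ᴺ` is a CM type. -/
theorem Φ24N_isCMType : IsCMType cc_C6xC2xC2 Φ24N := by decide

/-- `Φ₂₄ᴺ` is primitive. -/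
theorem Φ24N_isPrimitive : IsPrimitive Φ24N := by decide

/-- Every embedding lies in exactly two of the four corners `T₂₄ᴺ i`. -/
theorem sumTwo_T24N : SumTwo T24N := by
  unfold SumTwo; decide

/-- No two corners of `T₂₄ᴺ` are complex-conjugate types. -/
theorem T24N_noConjugatePair : ∀ i j : Fin 4, T24N j ≠ cc_C6xC2xC2 • T24N i := by decide

/-- `T₂₄ᴺ` is single-class by construction. -/
theorem T24N_isSingleClass : IsSingleClass T24N := fun i => ⟨g24 i, rfl⟩

/-- Pairing pattern `(2, 6, 4)`. -/
theorem T24N_pattern :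
    (Φ24N ∩ T24N 1).card = 2 ∧ (Φ24N ∩ T24N 2).card = 6 ∧ (Φ24N ∩ T24N 3).card = 4 := by decide

/-- The four corners are pairwise distinct. -/
theorem T24N_nodup : ∀ i j : Fin 4, T24N i = T24N j → i = j := by decide

/-- The Pohlmann `4`-set of `T₂₄ᴺ`: `Δᴺ = {1, g₁⁻¹, g₂⁻¹, g₃⁻¹}` (an embedding `x` lies in `Φ g_i` iff
`x g_i⁻¹ ∈ Φ`, so `SumTwo` says every left translate `xΔᴺ` meets `Φ₂₄ᴺ` in exactly two embeddings). -/
def Δ24N : Finset C6xC2xC2 := {1, (g24 1)⁻¹, (g24 2)⁻¹, (g24 3)⁻¹}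

/-- `⟨Δᴺ⟩` is an exceptional Hodge class candidate on `A_{Φ₂₄ᴺ}` (Pohlmann's condition, not conjugation-stable). -/
theorem Δ24N_isExceptional : IsExceptional cc_C6xC2xC2 Φ24N Δ24N := by decide

/-- `Δᴺ` is NOT a coset of any subgroup of `C₆ × C₂ × C₂`: the class is Weil relative to no subfield. -/
theorem Δ24N_not_coset :
    ¬ ∃ (H : Subgroup C6xC2xC2) (h : C6xC2xC2), ∀ x, x ∈ Δ24N ↔ ∃ k ∈ H, x = k * h :=
  not_exists_coset_of_forall Δ24N (by decide)

/-- **A non-coset single-class `SumTwo` quadruple without a conjugate pair on an ABELIAN group** (order `24`),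
with a primitive base type: the third mechanism of the degree-24 frontier, on the kernel. -/
theorem exists_singleClass_sumTwo_nonCoset_C6xC2xC2 :
    ∃ T : Fin 4 → Finset C6xC2xC2, IsCMType cc_C6xC2xC2 (T 0) ∧ IsPrimitive (T 0) ∧ SumTwo T ∧
      (∀ i j : Fin 4, T j ≠ cc_C6xC2xC2 • T i) ∧ IsSingleClass T ∧
      ¬ ∃ (H : Subgroup C6xC2xC2) (h : C6xC2xC2),
        ∀ x, x ∈ ({1, (g24 1)⁻¹, (g24 2)⁻¹, (g24 3)⁻¹} : Finset C6xC2xC2) ↔ ∃ k ∈ H, x = k * h :=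
  ⟨T24N, Φ24N_isCMType, Φ24N_isPrimitive, sumTwo_T24N, T24N_noConjugatePair, T24N_isSingleClass,
    Δ24N_not_coset⟩

/-- `Φ₂₄ᴺ` is DEGENERATE (Hazama's shadow). -/
theorem Φ24N_not_isNondegenerate : ¬ IsNondegenerate Φ24N := fun hnd =>
  HazamaShadow.not_isSingleClass_of_isNondegenerate cc_C6xC2xC2_isComplexConj T24N Φ24N_isCMType hnd
    sumTwo_T24N T24N_noConjugatePair T24N_isSingleClass

end HodgeRepro
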